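import Summits.ResolutionOfSingularities.ResolutionOfSingularities.Theorems.FrobeniusLadderFInjectiveMacaulayficationFedderOrigin
import Summits.ResolutionOfSingularities.ResolutionOfSingularities.Theorems.FrobeniusLadderFInjectiveMacaulayficationThreefoldOriginNotClause
import HarnessLib

/-!
# The point-blow-up tower over `f₄ = X₂² + X₀³ + X₁⁶ + X₃³X₀²` is never F-injective (char. `5`)

Support file for crux stmt-ResolutionOfSingularities-15315 (`FrobeniusLadder.FInjectiveMacaulayfication`,
line `Sketch`): stub `stub_pointTowerNeverFInjective` — the NEGATIVE calibration of the point-blow-up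
engine in dimension `3`, characteristic `5`.

Let `k` be a field of characteristic `5`, `S = k[X₀, X₁, X₂, X₃]`, `𝔪 = (X₀, X₁, X₂, X₃)` and, for `m : ℕ`,
`g_m = X₂² + X₃³X₀² + X₃^m X₀³ + X₃^{4m} X₁⁶` (`g₀ = f₄ = X₂² + X₀³ + X₁⁶ + X₃³X₀²`, a Cohen–Macaulay
threefold hypersurface which is non-F-injective exactly at its origin). Blowing up the origin and
restricting to the `X₃`-chart `θ₃ : X₃ ↦ X₃, Xⱼ ↦ XⱼX₃ (j ≠ 3)` — the chart containing the point where
the strict transform of the singular `X₃`-axis meets the exceptional divisor — gives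
`θ₃ g_m = X₃² · g_{m+1}`: the strict transform of `g_m` at that point is `g_{m+1}`, so the tower of
point blow-ups runs through the whole family `(g_m)_m`. And for EVERY `m` Fedder's test fails at the
origin: `g_m⁴ ∈ (X₀⁵, X₁⁵, X₂⁵, X₃⁵) = 𝔪^[5]`, hence (Fedder's criterion at the origin,
`Fedder.fedder_criterion_origin`, an iff) the local ring of `S/(g_m)` at the origin violates the per-stalk
clause of the crux ("every system of parameters is weakly regular and generates a Frobenius closed
ideal"). Point blow-ups alone therefore never F-injectivize `f₄`.

What is proved (all memberships over an arbitrary commutative ring):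

* `pointTower_chart_identity` — `θ₃ g_m = X₃² g_{m+1}` (a `ring` identity);
* `pointTower_pow_four_mem` — `g_m⁴ ∈ (X₀⁵, X₁⁵, X₂⁵, X₃⁵)`: writing `g_m = a + b` with `a = X₂²`,
  `b = X₃³X₀² + X₃^m X₀³ + X₃^{4m} X₁⁶`, one has `a³ = X₂·X₂⁵` and
  `b² = X₀⁴X₃·X₃⁵ + (2X₃^{m+3} + X₃^{2m}X₀)·X₀⁵ + (…)·X₁⁵`, and
  `(a + b)⁴ = a³(a + 4b) + b²(6a² + 4ab + b²)` (`add_pow_four_mem`);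
* `pointTower_mem_span_range_X`, `pointTower_ne_zero` — `g_m ∈ 𝔪`, `g_m ≠ 0` (`g_m(0,0,1,0) = 1`);
* `pointTower_origin_not_clause_local` — `S_𝔪/(g_m)` violates the clause (Fedder);
* `pointTower_origin_not_clause` — the affine form: the local ring of `S/(g_m)` at the image `𝔪̄` of
  `𝔪` (a maximal ideal containing all `X̄ⱼ`) violates the clause, transported from `S_𝔪/(g_m)` along
  `S_𝔪/(g_m) ≅ (S/(g_m))_{𝔪̄}` (`QuotLocalizationIso.stub_quotLocalizationIso`,
  `DegreeZeroDescent.inlineClause_of_ringEquiv`) exactly as in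
  `ThreefoldOriginNotClause.threefold_origin_not_clause`;
* `stub_pointTowerNeverFInjective` — the registered form (the three conjuncts together).

References: R. Fedder, *F-purity and rational singularity*, Trans. AMS 278 (1983), Prop. 1.7 and
Thm. 1.12 [Fedder1983] (through the imported criterion). The computations themselves are folklore.
-/

-- single-problem summit: the doubled namespace component is forced
set_option linter.dupNamespace false

namespace Summit.ResolutionOfSingularities.ResolutionOfSingularities.Theorems.FInjectiveMacaulayfication.PointTowerNeverFInjective

open MvPolynomial
open Summit.ResolutionOfSingularities.ResolutionOfSingularities.Theorems.FInjectiveMacaulayfication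

section Poly

variable (k : Type) [CommRing k]

/-- **The chart identity of the tower:** for `θ₃ : X₃ ↦ X₃, Xⱼ ↦ XⱼX₃ (j ≠ 3)` (the `X₃`-chart of the
blow-up of the origin) and `g_m = X₂² + X₃³X₀² + X₃^m X₀³ + X₃^{4m} X₁⁶`, `θ₃ g_m = X₃² · g_{m+1}` — the
strict transform of `g_m` at the origin of the chart is `g_{m+1}` (multiplicity `2`). [folklore] -/
theorem pointTower_chart_identity (m : ℕ) :
    MvPolynomial.aeval (fun j : Fin 4 => if j = 3 then (X 3 : MvPolynomial (Fin 4) k) else X j * X 3)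
        (X 2 ^ 2 + X 3 ^ 3 * X 0 ^ 2 + X 3 ^ m * X 0 ^ 3 + X 3 ^ (4 * m) * X 1 ^ 6 :
          MvPolynomial (Fin 4) k) =
      X 3 ^ 2 * (X 2 ^ 2 + X 3 ^ 3 * X 0 ^ 2 + X 3 ^ (m + 1) * X 0 ^ 3 + X 3 ^ (4 * (m + 1)) * X 1 ^ 6) := by
  simp only [map_add, map_mul, map_pow, MvPolynomial.aeval_X, Fin.isValue, Fin.reduceEq, ↓reduceIte]
  ring

/-- `(a + b)⁴ ∈ Q` as soon as `a³ ∈ Q` and `b² ∈ Q`: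
`(a + b)⁴ = a³(a + 4b) + b²(6a² + 4ab + b²)`. [folklore] -/
theorem add_pow_four_mem {R : Type*} [CommRing R] (Q : Ideal R) {a b : R} (ha : a ^ 3 ∈ Q)
    (hb : b ^ 2 ∈ Q) : (a + b) ^ 4 ∈ Q := by
  have h : (a + b) ^ 4 = a ^ 3 * (a + 4 * b) + b ^ 2 * (6 * a ^ 2 + 4 * a * b + b ^ 2) := by ring
  rw [h]
  exact add_mem (Ideal.mul_mem_right _ _ ha) (Ideal.mul_mem_right _ _ hb)

/-- **Fedder's test fails along the whole tower (`p = 5`):** `g_m⁴ ∈ (X₀⁵, X₁⁵, X₂⁵, X₃⁵)` for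
`g_m = X₂² + X₃³X₀² + X₃^m X₀³ + X₃^{4m} X₁⁶` and every `m`. With `a = X₂²` and
`b = X₃³X₀² + X₃^m X₀³ + X₃^{4m} X₁⁶`: `a³ = X₂ · X₂⁵`,
`b² = (X₀⁴X₃)·X₃⁵ + (2X₃^{m+3} + X₃^{2m}X₀)·X₀⁵ + (X₃^{8m}X₁⁷ + 2X₃^{4m+3}X₀²X₁ + 2X₃^{5m}X₀³X₁)·X₁⁵`,
and `add_pow_four_mem`. [cite: Fedder1983, Prop. 1.7] -/
theorem pointTower_pow_four_mem (m : ℕ) :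
    (X 2 ^ 2 + X 3 ^ 3 * X 0 ^ 2 + X 3 ^ m * X 0 ^ 3 + X 3 ^ (4 * m) * X 1 ^ 6 :
        MvPolynomial (Fin 4) k) ^ 4 ∈
      Ideal.span (Set.range fun i : Fin 4 => (X i : MvPolynomial (Fin 4) k) ^ 5) := by
  have hX : ∀ i : Fin 4, (X i : MvPolynomial (Fin 4) k) ^ 5 ∈
      Ideal.span (Set.range fun i : Fin 4 => (X i : MvPolynomial (Fin 4) k) ^ 5) :=
    fun i => Ideal.subset_span ⟨i, rfl⟩
  have hg : (X 2 ^ 2 + X 3 ^ 3 * X 0 ^ 2 + X 3 ^ m * X 0 ^ 3 + X 3 ^ (4 * m) * X 1 ^ 6 :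
        MvPolynomial (Fin 4) k) =
      X 2 ^ 2 + (X 3 ^ 3 * X 0 ^ 2 + X 3 ^ m * X 0 ^ 3 + X 3 ^ (4 * m) * X 1 ^ 6) := by
    ring
  rw [hg]
  refine add_pow_four_mem _ ?_ ?_
  · -- `a³ = X₂⁶ = X₂ · X₂⁵`
    rw [show ((X 2 : MvPolynomial (Fin 4) k) ^ 2) ^ 3 = X 2 * X 2 ^ 5 by ring]
    exact Ideal.mul_mem_left _ _ (hX 2)
  · -- `b²`, with explicit cofactors
    have hb : (X 3 ^ 3 * X 0 ^ 2 + X 3 ^ m * X 0 ^ 3 + X 3 ^ (4 * m) * X 1 ^ 6 :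
          MvPolynomial (Fin 4) k) ^ 2 =
        (X 0 ^ 4 * X 3) * X 3 ^ 5 + (2 * X 3 ^ (m + 3) + X 3 ^ (2 * m) * X 0) * X 0 ^ 5 +
          (X 3 ^ (8 * m) * X 1 ^ 7 + 2 * X 3 ^ (4 * m + 3) * X 0 ^ 2 * X 1 +
            2 * X 3 ^ (5 * m) * X 0 ^ 3 * X 1) * X 1 ^ 5 := by
      ring
    rw [hb]
    exact add_mem (add_mem (Ideal.mul_mem_left _ _ (hX 3)) (Ideal.mul_mem_left _ _ (hX 0)))
      (Ideal.mul_mem_left _ _ (hX 1))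

/-- Every `g_m = X₂² + X₃³X₀² + X₃^m X₀³ + X₃^{4m} X₁⁶` lies in the ideal `(X₀, X₁, X₂, X₃)` of the
origin (no constant term: each summand is a multiple of `X₂`, `X₀`, `X₀`, `X₁` respectively). [folklore] -/
theorem pointTower_mem_span_range_X (m : ℕ) :
    (X 2 ^ 2 + X 3 ^ 3 * X 0 ^ 2 + X 3 ^ m * X 0 ^ 3 + X 3 ^ (4 * m) * X 1 ^ 6 :
        MvPolynomial (Fin 4) k) ∈
      Ideal.span (Set.range (X : Fin 4 → MvPolynomial (Fin 4) k)) := by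
  have hX : ∀ i : Fin 4, (X i : MvPolynomial (Fin 4) k) ∈
      Ideal.span (Set.range (X : Fin 4 → MvPolynomial (Fin 4) k)) :=
    fun i => Ideal.subset_span ⟨i, rfl⟩
  exact add_mem (add_mem (add_mem (Ideal.pow_mem_of_mem _ (hX 2) 2 (by norm_num))
    (Ideal.mul_mem_left _ _ (Ideal.pow_mem_of_mem _ (hX 0) 2 (by norm_num))))
    (Ideal.mul_mem_left _ _ (Ideal.pow_mem_of_mem _ (hX 0) 3 (by norm_num))))
    (Ideal.mul_mem_left _ _ (Ideal.pow_mem_of_mem _ (hX 1) 6 (by norm_num)))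

/-- Every `g_m = X₂² + X₃³X₀² + X₃^m X₀³ + X₃^{4m} X₁⁶` is non-zero over a non-trivial commutative ring:
`g_m(0, 0, 1, 0) = 1` (also for `m = 0`, where `X₃⁰ = 1` but the cofactors `X₀³`, `X₁⁶` vanish).
[folklore] -/
theorem pointTower_ne_zero [Nontrivial k] (m : ℕ) :
    (X 2 ^ 2 + X 3 ^ 3 * X 0 ^ 2 + X 3 ^ m * X 0 ^ 3 + X 3 ^ (4 * m) * X 1 ^ 6 :
        MvPolynomial (Fin 4) k) ≠ 0 := by
  intro h0
  have h1 := congrArg (MvPolynomial.eval (fun j : Fin 4 => if j = 2 then (1 : k) else 0)) h0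
  simp only [map_add, map_mul, map_pow, MvPolynomial.eval_X, Fin.isValue, Fin.reduceEq, ↓reduceIte,
    map_zero] at h1
  norm_num at h1

end Poly

section FieldCase

variable (k : Type) [Field k] [CharP k 5]

/-- **Every storey of the tower violates the clause at its origin** (local-ring level): for
`S = k[X₀, X₁, X₂, X₃]` over a field of characteristic `5`, `P = (X₀, X₁, X₂, X₃)` and
`g = g_m = X₂² + X₃³X₀² + X₃^m X₀³ + X₃^{4m} X₁⁶`, the hypersurface local ring `S_P/(g)` does NOT satisfy
"all s.o.p. weakly regular and all parameter ideals Frobenius closed": `g^(5-1) ∈ (X₀⁵, …, X₃⁵)`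
(`pointTower_pow_four_mem`), so Fedder's criterion at the origin (`Fedder.fedder_criterion_origin`, an
iff) fails. [cite: Fedder1983, Thm. 1.12] -/
theorem pointTower_origin_not_clause_local (P : Ideal (MvPolynomial (Fin 4) k)) [P.IsMaximal]
    (hP : P = Ideal.span (Set.range (MvPolynomial.X : Fin 4 → MvPolynomial (Fin 4) k)))
    (m : ℕ) (g : MvPolynomial (Fin 4) k)
    (hg : g = MvPolynomial.X 2 ^ 2 + MvPolynomial.X 3 ^ 3 * MvPolynomial.X 0 ^ 2 +
      MvPolynomial.X 3 ^ m * MvPolynomial.X 0 ^ 3 + MvPolynomial.X 3 ^ (4 * m) * MvPolynomial.X 1 ^ 6) :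
    ¬ (∀ d : ℕ, ringKrullDim (Localization.AtPrime P ⧸ Ideal.span {algebraMap (MvPolynomial (Fin 4) k)
        (Localization.AtPrime P) g}) = d →
      ∀ s : Fin d → Localization.AtPrime P ⧸ Ideal.span {algebraMap (MvPolynomial (Fin 4) k)
          (Localization.AtPrime P) g},
        Ideal.IsMaximal (Ideal.radical (Ideal.span (Set.range s))) →
          RingTheory.Sequence.IsWeaklyRegular (Localization.AtPrime P ⧸ Ideal.span
              {algebraMap (MvPolynomial (Fin 4) k) (Localization.AtPrime P) g}) (List.ofFn s) ∧
          ∀ y : Localization.AtPrime P ⧸ Ideal.span {algebraMap (MvPolynomial (Fin 4) k)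
              (Localization.AtPrime P) g},
            (∃ e : ℕ, y ^ 5 ^ e ∈ Ideal.span ((fun z : Localization.AtPrime P ⧸ Ideal.span
                {algebraMap (MvPolynomial (Fin 4) k) (Localization.AtPrime P) g} => z ^ 5 ^ e) ''
                  (Ideal.span (Set.range s) : Set (Localization.AtPrime P ⧸ Ideal.span
                    {algebraMap (MvPolynomial (Fin 4) k) (Localization.AtPrime P) g})))) →
              y ∈ Ideal.span (Set.range s)) := by
  haveI : Fact (Nat.Prime 5) := ⟨Nat.prime_five⟩
  have hgP : g ∈ P := by
    rw [hP, hg]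
    exact pointTower_mem_span_range_X k m
  have hg0 : g ≠ 0 := by
    rw [hg]
    exact pointTower_ne_zero k m
  rw [Fedder.fedder_criterion_origin 5 k 4 P hP g hgP hg0, not_not, hg,
    show (5 : ℕ) - 1 = 4 from rfl]
  exact pointTower_pow_four_mem k m

/-- **No storey of the tower is a model over the origin**: in characteristic `5` the affine threefold
`k[X₀, X₁, X₂, X₃]/(g_m)`, `g_m = X₂² + X₃³X₀² + X₃^m X₀³ + X₃^{4m} X₁⁶`, violates the clause at its
local ring at the origin `𝔪̄` — the image of `(X₀, X₁, X₂, X₃)`, a maximal ideal containing every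
`X̄ⱼ`: `pointTower_origin_not_clause_local` (Fedder's criterion), transported from `k[X]_{(X)}/(g_m)`
to `(k[X]/(g_m))_{𝔪̄}` along `QuotLocalizationIso.stub_quotLocalizationIso` by
`DegreeZeroDescent.inlineClause_of_ringEquiv`. [cite: Fedder1983, Thm. 1.12] -/
-- adapted from `ThreefoldOriginNotClause.threefold_origin_not_clause` (same transport, `p = 2`)
theorem pointTower_origin_not_clause (m : ℕ) (g : MvPolynomial (Fin 4) k)
    (hg : g = MvPolynomial.X 2 ^ 2 + MvPolynomial.X 3 ^ 3 * MvPolynomial.X 0 ^ 2 +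
      MvPolynomial.X 3 ^ m * MvPolynomial.X 0 ^ 3 + MvPolynomial.X 3 ^ (4 * m) * MvPolynomial.X 1 ^ 6) :
    ∃ (P : Ideal (MvPolynomial (Fin 4) k ⧸ Ideal.span {g})) (_ : P.IsMaximal),
      (∀ j : Fin 4, Ideal.Quotient.mk (Ideal.span {g}) (MvPolynomial.X j) ∈ P) ∧
      ¬ (∀ d : ℕ, ringKrullDim (Localization.AtPrime P) = d → ∀ s : Fin d → Localization.AtPrime P,
        (Ideal.span (Set.range s)).radical.IsMaximal →
          RingTheory.Sequence.IsWeaklyRegular (Localization.AtPrime P) (List.ofFn s) ∧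
          ∀ y : Localization.AtPrime P, (∃ e : ℕ, y ^ 5 ^ e ∈ Ideal.span
            ((fun z : Localization.AtPrime P => z ^ 5 ^ e) ''
              (Ideal.span (Set.range s) : Set (Localization.AtPrime P)))) → y ∈ Ideal.span (Set.range s)) := by
  haveI hmax : (Ideal.span (Set.range (MvPolynomial.X : Fin 4 → MvPolynomial (Fin 4) k))).IsMaximal :=
    Fedder.isMaximal_span_range_X k 4
  have hXm : ∀ j : Fin 4, (X j : MvPolynomial (Fin 4) k) ∈
      Ideal.span (Set.range (MvPolynomial.X : Fin 4 → MvPolynomial (Fin 4) k)) :=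
    fun j => Ideal.subset_span ⟨j, rfl⟩
  have hgm : g ∈ Ideal.span (Set.range (MvPolynomial.X : Fin 4 → MvPolynomial (Fin 4) k)) := by
    rw [hg]
    exact pointTower_mem_span_range_X k m
  have hker : RingHom.ker (Ideal.Quotient.mk (Ideal.span {g})) ≤
      Ideal.span (Set.range (MvPolynomial.X : Fin 4 → MvPolynomial (Fin 4) k)) := by
    rw [Ideal.mk_ker, Ideal.span_singleton_le_iff_mem]
    exact hgm
  obtain ⟨hPmax, hcomap⟩ := BlowupFiModel.isMaximal_map_and_comap_map_of_surjective
    (Ideal.Quotient.mk (Ideal.span {g})) Ideal.Quotient.mk_surjective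
    (Ideal.span (Set.range (MvPolynomial.X : Fin 4 → MvPolynomial (Fin 4) k))) hker
  haveI := hPmax
  refine ⟨_, hPmax, fun j => Ideal.mem_map_of_mem _ (hXm j), fun hclause => ?_⟩
  obtain ⟨e⟩ := QuotLocalizationIso.stub_quotLocalizationIso (MvPolynomial (Fin 4) k) g
    (Ideal.span (Set.range (MvPolynomial.X : Fin 4 → MvPolynomial (Fin 4) k))) _ hcomap
  have key := DegreeZeroDescent.inlineClause_of_ringEquiv 5 e.symm hclause
  exact pointTower_origin_not_clause_local k _ rfl m g hg key

end FieldCase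

/-- **NEGATIVE CALIBRATION OF THE POINT-BLOW-UP ENGINE — registered form** (stub
`stub_pointTowerNeverFInjective` of crux stmt-ResolutionOfSingularities-15315, line `Sketch`): for every
field `k` of characteristic `5`, every `m : ℕ` and `g = g_m = X₂² + X₃³X₀² + X₃^m X₀³ + X₃^{4m} X₁⁶`
(`g₀ = f₄`):
(i) `θ₃ g_m = X₃² · g_{m+1}` — the strict transform on the `X₃`-chart of the point blow-up is the next
storey (`pointTower_chart_identity`);
(ii) `g_m⁴ ∈ (X₀⁵, X₁⁵, X₂⁵, X₃⁵)` — Fedder's test fails (`pointTower_pow_four_mem`);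
(iii) the local ring of `k[X₀, …, X₃]/(g_m)` at the origin (a maximal ideal containing all `X̄ⱼ`)
violates "every system of parameters is weakly regular and generates a Frobenius closed ideal"
(`pointTower_origin_not_clause`). [cite: Fedder1983, Prop. 1.7 and Thm. 1.12] -/
theorem stub_pointTowerNeverFInjective : ∀ (k : Type) [Field k] [CharP k 5] (m : ℕ) (g : MvPolynomial (Fin 4) k),
    g = MvPolynomial.X 2 ^ 2 + MvPolynomial.X 3 ^ 3 * MvPolynomial.X 0 ^ 2 + MvPolynomial.X 3 ^ m * MvPolynomial.X 0 ^ 3 + MvPolynomial.X 3 ^ (4 * m) * MvPolynomial.X 1 ^ 6 →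
    MvPolynomial.aeval (fun j : Fin 4 => if j = 3 then (MvPolynomial.X 3 : MvPolynomial (Fin 4) k) else MvPolynomial.X j * MvPolynomial.X 3) g =
      MvPolynomial.X 3 ^ 2 * (MvPolynomial.X 2 ^ 2 + MvPolynomial.X 3 ^ 3 * MvPolynomial.X 0 ^ 2 + MvPolynomial.X 3 ^ (m + 1) * MvPolynomial.X 0 ^ 3 + MvPolynomial.X 3 ^ (4 * (m + 1)) * MvPolynomial.X 1 ^ 6) ∧
    g ^ 4 ∈ Ideal.span (Set.range fun i : Fin 4 => (MvPolynomial.X i : MvPolynomial (Fin 4) k) ^ 5) ∧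
    ∃ (P : Ideal (MvPolynomial (Fin 4) k ⧸ Ideal.span {g})) (_ : P.IsMaximal),
      (∀ j : Fin 4, Ideal.Quotient.mk (Ideal.span {g}) (MvPolynomial.X j) ∈ P) ∧
      ¬ (∀ d : ℕ, ringKrullDim (Localization.AtPrime P) = d → ∀ s : Fin d → Localization.AtPrime P,
        (Ideal.span (Set.range s)).radical.IsMaximal →
          RingTheory.Sequence.IsWeaklyRegular (Localization.AtPrime P) (List.ofFn s) ∧
          ∀ y : Localization.AtPrime P, (∃ e : ℕ, y ^ 5 ^ e ∈ Ideal.span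
            ((fun z : Localization.AtPrime P => z ^ 5 ^ e) ''
              (Ideal.span (Set.range s) : Set (Localization.AtPrime P)))) → y ∈ Ideal.span (Set.range s)) := by
  intro k _ _ m g hg
  refine ⟨?_, ?_, pointTower_origin_not_clause k m g hg⟩
  · -- (i) the chart identity
    rw [hg]
    exact pointTower_chart_identity k m
  · -- (ii) Fedder's test fails
    rw [hg]
    exact pointTower_pow_four_mem k m

end Summit.ResolutionOfSingularities.ResolutionOfSingularities.Theorems.FInjectiveMacaulayfication.PointTowerNeverFInjective
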